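import Literature.Computability.Complexity.GateEliminationDoomed
import Literature.Computability.Complexity.GateEliminationDimension

/-!
# Gate elimination: doomed-gate cascades with the sharp dimension bound

Copies of `elimDataDConstFed` / `cascade_doomed` (`GateEliminationDoomed.lean`) with the hypothesis
`2d + 1 ≤ dim R` instead of `2d + 2 ≤ dim R`, using `out_ne_of_live_var'`
(`GateEliminationDimension.lean`): needed for the eliminations after the second substitution of a
two-substitution case (Li–Yang §4.1, e.g. Case 5.4.1.3), where only `dim R'' = dim R - 2 ≥ 2d + 1`
is available. Everything PROVED.

## References

* J. Li, T. Yang, *3.1n − o(n) circuit lower bounds for explicit functions*, STOC 2022;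
  ECCC TR21-023, §3.3, Lemma 3.11, Prop. 2.4.
-/

namespace Literature.Computability.Complexity

open Finset

namespace Semicircuit

variable {n : ℕ} {C : Semicircuit n} {k₀ : Fin C.m} {f : (Fin n → ZMod 2) → Bool} {R : RdqSource n}
  {αφ αI αQ : ℝ} {P : Finset (Fin C.m × Fin C.m)} {d : ℕ}

/-- **Elimination data (with doomed gates) for a gate fed by a constant**, with the sharper
dimension bound `2d + 1 ≤ dim R` of `out_ne_of_live_var'` (needed after two substitutions).
[cite: LiYang2022, Lemma 3.11 (Rules 2, 3)] -/
noncomputable def elimDataDConstFed' (hf : IsAffineDisperser f d) (hd : 2 * d + 1 ≤ R.dim) (hF : C.Fair)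
    (hC : C.ComputesRestr f R) {P : Finset (Fin C.m × Fin C.m)} (hP : C.IsPacking P)
    {a₀ : Fin 2} {b : Bool} (h₀ : C.arg k₀ a₀ = .const b)
    (hφ : 0 ≤ αφ) (hI : 0 ≤ αI) (αQ : ℝ) : ElimDataD C k₀ f R αφ αI αQ P (1 - αφ) := by
  have hself := hF.not_reads_self_of_const h₀
  by_cases htriv : C.liveFn k₀ a₀ b false = C.liveFn k₀ a₀ b true
  · exact elimDataDTriv hF hC hP h₀ htriv (out_ne_of_trivialized hf (by omega) hF hC h₀ htriv) hφ hI αQ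
  · have hdeg : ∀ t, C.liveFn k₀ a₀ b t = (t ^^ C.liveFn k₀ a₀ b false) :=
      (bool_fn_const_or_xor _).resolve_left htriv
    by_cases hout : C.out = .gate k₀
    · -- the output gate: its live input is a gate `k₁`
      cases hk₁ : C.arg k₀ a₀.rev with
      | const b' => exact absurd hout (out_ne_of_const_const hf (by omega) hF hC h₀ hk₁)
      | var i => exact absurd hout (out_ne_of_live_var' hf hd hF hC h₀ hk₁)
      | gate k₁ =>
      have hk : k₀ ≠ k₁ := fun h => hself a₀.rev (by rw [hk₁, h])
      cases hneg : C.liveFn k₀ a₀ b false with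
      | false =>
        rw [hneg] at hdeg
        have hval : ∀ (x : Fin n → Bool) (w : Fin C.m → Bool), C.Consistent x w →
            C.nodeVal x w (C.arg k₀ a₀.rev) = C.nodeVal x w C.out := by
          intro x w hw
          rw [hout]
          show _ = w k₀
          rw [hw k₀, op_eq_liveFn h₀, hdeg, Bool.xor_false]
        exact ElimDataD.ofSetOut (v := C.arg k₀ a₀.rev)
          (elimDataDBypass (C := C.setOut (C.arg k₀ a₀.rev)) (k₀ := k₀) hF.setOut (hC.setOut hval)
            ((C.isPacking_setOut_iff _ P).mpr hP) false h₀ hdeg (hself a₀.rev) hφ hI αQ)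
      | true =>
        rw [hneg] at hdeg
        let C₂ := C.flipGate k₁
        have hF₂ : C₂.Fair := hF.flipGate
        have hC₂ : C₂.ComputesRestr f R := hC.flipGate (by rw [hout]; exact fun h => hk (Node.gate.inj h))
        have hP₂ : C₂.IsPacking P := (C.isPacking_flipGate_iff k₁ P).mpr hP
        have hdeg₂ : ∀ t, C₂.liveFn k₀ a₀ b t = (t ^^ false) := fun t => by
          rw [C.liveFn_flipGate hk h₀, hk₁, decide_eq_true rfl, hdeg]
          cases t <;> rfl
        have hval : ∀ (x : Fin n → Bool) (w : Fin C.m → Bool), C₂.Consistent x w →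
            C₂.nodeVal x w (C₂.arg k₀ a₀.rev) = C₂.nodeVal x w C₂.out := by
          intro x w hw
          show C₂.nodeVal x w (C.arg k₀ a₀.rev) = C₂.nodeVal x w C.out
          rw [hout]
          show _ = w k₀
          rw [hw k₀, op_eq_liveFn (C := C₂) h₀, hdeg₂, Bool.xor_false]
        refine ElimDataD.ofFlipGate (k₁ := k₁) (ElimDataD.ofSetOut (v := C.arg k₀ a₀.rev)
          (elimDataDBypass (C := C₂.setOut (C.arg k₀ a₀.rev)) (k₀ := k₀) hF₂.setOut (hC₂.setOut hval)
            ((C₂.isPacking_setOut_iff _ P).mpr hP₂) false h₀ hdeg₂ (hself a₀.rev) hφ hI αQ)) hk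
    · exact elimDataDBypass hF hC hP _ h₀ hdeg hout hφ hI αQ

/-! ### The generalized cascade -/

/-- **Generalized cascade of Rules 2/3** with the sharper dimension bound `2d + 1 ≤ dim R`
(as `cascade_doomed`). [cite: LiYang2022, §3.3, Lemma 3.11, §4.1] -/
theorem cascade_doomed' (hf : IsAffineDisperser f d) (hd : 2 * d + 1 ≤ R.dim) (hφ : 0 ≤ αφ) (hI : 0 ≤ αI)
    (αQ : ℝ) :
    ∀ (r : ℕ) (D : Semicircuit n) (P : Finset (Fin D.m × Fin D.m)), D.Fair → D.ComputesRestr f R →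
      D.IsPacking P → r ≤ D.doomed.card →
      ∃ (D' : Semicircuit n) (P' : Finset (Fin D'.m × Fin D'.m)), D'.Fair ∧ D'.ComputesRestr f R ∧
        D'.IsPacking P' ∧ D'.m + r = D.m ∧
        D'.measure αφ αI αQ P' R ≤ D.measure αφ αI αQ P R - r * (1 - αφ) := by
  classical
  intro r
  induction r with
  | zero =>
    intro D P hF hC hP _
    exact ⟨D, P, hF, hC, hP, by simp, by simp⟩
  | succ r ih =>
    intro D P hF hC hP hr
    -- pick a gate fed by a constant
    have hne : D.doomed.Nonempty := by rw [← card_pos]; omega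
    have hcf := D.constFedCount_pos_of_doomed_nonempty hne
    obtain ⟨k₀, hk₀⟩ : (univ.filter fun k => ∃ a b, D.arg k a = .const b).Nonempty := by
      rw [← card_pos]; exact hcf
    obtain ⟨a₀, b, h₀⟩ := (mem_filter.mp hk₀).2
    let E := elimDataDConstFed' (C := D) (k₀ := k₀) hf hd hF hC hP h₀ hφ hI αQ
    have hcount : r ≤ E.C'.doomed.card := by
      have := E.card_doomed_le; omega
    obtain ⟨D', P', hF', hC', hP', hm, hμ⟩ := ih E.C' E.P' E.fair E.computes E.packing hcount
    refine ⟨D', P', hF', hC', hP', ?_, ?_⟩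
    · have := E.m_add_one; omega
    · have := E.measure_le
      push_cast
      linarith

end Semicircuit

end Literature.Computability.Complexity
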